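import Summits.AtomisticToContinuum.Crystallization.Theorems.ChargedEnergyGapRoofCover
import HarnessLib

/-!
(SPLIT FOR THE 400-LINE CAP by the landing lane, hand-2 g37: this file = part 1 of 2 (§1 Beams, §2 Leaves, §3 Bridge); the sequel `…ChargedEnergyGapBeamCells` (§4 Glue, §5 Designate) imports it; same namespace, all FQNs unchanged.)
# Charged energy gap — NODE 77 «BeamCells»: the residual (KX) of NODE 76R made LOCAL by an explicit two-currency TRANSPORT (lens-3 g77)

Beneath NODE 76R's residual leaf (KX) `CreaseTransitionLedgerQ cls₀ 20 106 (1/3600000000) …` (tree `…ChargedEnergyGapRoofCoverA` l.314: the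
roof ledger of the shell octahedra that are NOT (χ-free and tame) — creases / ridges / junction cores of `dist(·, C)` and octahedra touching a
χ-transition — against the GLOBAL periodic budget `c_T·shellMassL − 6κ·sVertMassL + cχ·transMassL + c_H·pricedNearCountL`) we type the door
[BEAM] of critic row 1390 as an EXPLICIT TRANSPORT of the budget to the costly octahedra, so that (KX) splits into PER-OCTAHEDRON inequalities
of bounded radius plus one periodic double count.  The objects (§1):

* `IsActive` — an ACTIVE octahedron: a clean non-plateau shell octahedron of the class `¬(χ-free ∧ (tame ∨ d_K-deep))` whose frame-infimum
  `frameVal (roofVal T75) τ W` is POSITIVE (zero-cost octahedra take no part: they neither pay nor collect);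
* `tubeC` / `tubeD` / `tube` — the BEAM TUBES of an octahedron: the `r`-neighbourhoods of the segments from its sites to their nearest points
  («feet», `nearestPts`) on `closure C` — only for a CREASED octahedron with a site of depth `< ϱ` — and, from each site in transition for a listed
  set `Dᵢ`, to its feet on `closure Dᵢ` (INTO the transition band); plus the octahedron's own sites;
* `atom` — the BUDGET ATOM of a site: `c_T·χ(x)·[0 < w(x) < 1] − 6κ·sVertInd(x) + cχ·w(x)·alive(x)·mult(x)²` off the excision (`≥ 0` once
  `6κ ≤ c_T`, PROVED `atom_nonneg`); `beamCount x` — the number of active octahedra (ordered shell pairs) whose tube contains `x`;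
  `income (y, z) = Σ_{x ∈ P.points ∩ tube} atom(x)/beamCount(x)` — every atom is shared EQUALLY among the active octahedra drawing on it.

The node (0 sorry; glue, bridge and dictionary PROVED; `c_H := 0`):

  (KX) ⟸ (Z_K) `SixFeetZeroConeQ (679/1000) (691/1000) 330 130 160` ∧ (B_C) `CreaseBeamQ` ∧ (B_D) `BandBeamQ` ∧ (N_B) `BeamIncidenceQ`

* (Z_K) ANY-FEET ZERO CONE [finite-dimensional, 20 parameters]: a six-feet pattern with feet of diameter `≤ 330 = 2ϱ + 6ρhi↑` (ANY crease type:
  fold, ridge, junction core, cylinder axis) and all six depths `≥ d_K = 130` has roof value `0` — the χ-free DEEP CREASES are free; bridge PROVED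
  (`crease_frame`: the any-feet dictionary `W∘vertices = φ∘feetDepth` for EVERY χ-free clean non-plateau octahedron, feet = nearest points, diameter
  `≤ 2ϱ + 6ρ`; `frameVal_nonpos_of_anyFeetZeroCone`);
* (B_C) CREASE BEAM INEQUALITY [per octahedron, radius `< 170`]: an active CREASED octahedron is paid by its income — `(1/6)·frameVal ≤ income`;
* (B_D) BAND BEAM INEQUALITY [per octahedron, radius `< 85`]: an active TAME octahedron (it touches a χ-transition) is paid by its income;
* (N_B) BEAM INCIDENCE [support, periodic Fubini]: over one period of active shell pairs the incomes add up to at most the budget of (KX).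

GLUE (`creaseTransitionLedgerQ_of_beams`, PROVED for any class, `0 ≤ κ`, `6κ ≤ c_T`, `0 ≤ cχ`): the residual class is PARTITIONED into the χ-free
deep creases (free by (Z_K)), the inactive rest (frame-infimum `≤ 0`: free by definition), the active creased ((B_C)) and the active tame ((B_D))
octahedra (`fShellSel_split` twice); termwise transfer; (N_B).  Designate `creaseTransitionLedgerQ_designate_of_beams` (tube radius `r = 3`,
`r_f = 20`, `d_K = 130`, `R_Z = 330`, `d⋆ = 106`, `κ = c_T/60`) and the q-designate cone `chargedEnergyGap_of_beamCells_numerics` (the tree cone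
`chargedEnergyGap_of_roofCover_numerics` with `hKX` replaced by the four leaves).

NEGATIVE KNOWLEDGE (g77 numerics `num/`, full-column LP roof of g75; informal): (i) LOCAL OWN-VERTEX CHARGING of the χ-touching octahedra is FALSE —
at the far edge `dist(·, Dᵢ) ∈ (74, 79)` of a «near Dᵢ» factor `1 − w_{80,Dᵢ}` an octahedron costs up to `62 c_T = 2.06 ×` the whole `cχ`-mass of
its six sites (family A, bulk band; two bands: `1.82 ×`); at the near edge `(47, 57)` of a «far» factor it costs `≤ 0.18 ×` — the `cχ`-currency must
be transported INTO the band (χ-beams), exactly as the `c_T`-currency must be transported along the feet columns to the `C`-creases (g76: starved slab,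
ratio `0.845`); (ii) OBLIVIOUS SHARING RULES are FALSE per octahedron in the starved slab of g76 (crease needs `0.845` of its columns): uniform
sharing among ALL residual-class octahedra drawing on a site dilutes the crease to `2/21` of its column (tame band octahedra hover over it), sharing
among the non-box octahedra still to `2/17` — hence activity := POSITIVE FRAME-INFIMUM (the LP roof itself decides who collects), `C`-beams only
for creased octahedra, χ-beams only from sites in transition; (iii) the ANY-FEET zero cone needs `d_K ≥ 127`: adversarial UNIAXIAL patterns (both
ends of one axis deeper — the axis of a cylindrical void of radius `≈ 126`) cost up to `19 c_T` at min-depth `124–126.4` although every fold /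
ridge / junction / cluster pattern is free from `122.8` on (`≈ 2·10⁵` samples; `d_K = 130` keeps a margin of `3.6`); (iv) desk rider (i) of row
1390: at min vertex depth pinned to `106` exactly (`r_f = 20`, 400 worst-orientation samples) the cost is `0` and the relative box slack of (Z₀) is
`ε* = 1.0 %` (min) / `2.1 %` (median); re-pinning `d⋆ := 110` doubles it (`2.0 % / 3.0 %`) at no cost to (S♯) (the added patterns are free).
-/

noncomputable section
open scoped Classical
open Literature.MathematicalPhysics.StatisticalMechanics Literature.Geometry.DiscreteGeometry
open Summit.AtomisticToContinuum.Crystallization.Theses.PricedLinkCensus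
open Summit.AtomisticToContinuum.Crystallization.Theorems.ChargedEnergyGapNegative

namespace Summit.AtomisticToContinuum.Crystallization.Theorems.ChargedEnergyGapChartDial

/-! ## §1 The active octahedra, the beam tubes, the budget atoms and the income -/

section Beams

variable (ϱχ : ℝ) {m : ℕ} (D : Fin m → Set E3) (σ : Fin m → Bool)

/-- The NEAREST POINTS ("feet") of `v` on the closure of `S`. -/
def nearestPts (S : Set E3) (v : E3) : Set E3 :=
  {q | q ∈ closure S ∧ dist v q = Metric.infDist v S}

/-- ★ **ACTIVE octahedron** of the residual class: a clean non-plateau shell octahedron `(y, z)` which is χ-TOUCHING or a SHALLOW CREASE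
(not: χ-free and (tame or `d_K`-deep)) and whose frame-infimum of `(τ·2ρ)²·roofVal T75 (W∘vertices)` is POSITIVE (only costly octahedra
take part in the transport).  Class algebra: `¬(cf ∧ tm) ∧ ¬(cf ∧ ¬tm ∧ dp) ↔ ¬(cf ∧ (tm ∨ dp))` (audit probe 13). -/
def IsActive (r_f dK : ℝ) (P : PeriodicConfiguration 3) (C X : Set E3) (τ ϱ r₁ r₂ : ℝ) (y z : E3) : Prop :=
  (y ∈ P.points ∧ z ∈ P.points ∧ r₁ < dist y z ∧ dist y z ≤ r₂) ∧ OctClean P r₁ X y z ∧ ¬OctPlateau P r₁ (siteW ϱχ D σ X ϱ C) y z ∧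
    ¬(OctChiFree ϱχ D P r₁ y z ∧ (OctTame r_f C P r₁ y z ∨ OctDeep dK C P r₁ y z)) ∧
      0 < frameVal (roofVal T75) τ (siteW ϱχ D σ X ϱ C) P r₁ y z

/-- The **C-BEAM TUBE** of the octahedron of `(y, z)` (radius `r`): the points within `r` of a segment from a site of the octahedron to one of
its feet on `closure C` — present only for a CREASED (`¬` tame) octahedron with a site of depth `< ϱ` (beams of length `< ϱ + 2(r₁ + r₂)`). -/
def tubeC (r r_f ϱ : ℝ) (C : Set E3) (P : PeriodicConfiguration 3) (r₁ : ℝ) (y z : E3) : Set E3 :=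
  {x | (¬OctTame r_f C P r₁ y z ∧ ¬OctDeep ϱ C P r₁ y z) ∧
    ∃ v, InOct P r₁ y z v ∧ ∃ q ∈ nearestPts C v, ∃ p ∈ segment ℝ v q, dist x p ≤ r}

/-- The **χ-BEAM TUBE** of the octahedron of `(y, z)` (radius `r`): the points within `r` of a segment from a site `v` of the octahedron IN
TRANSITION for a listed set `Dᵢ` to a foot of `v` on `closure Dᵢ` (beams of length `< ϱχ`, INTO the transition band of `Dᵢ`). -/
def tubeD (r : ℝ) (P : PeriodicConfiguration 3) (r₁ : ℝ) (y z : E3) : Set E3 :=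
  {x | ∃ v, InOct P r₁ y z v ∧ ∃ i, InTransition ϱχ D i v ∧ ∃ q ∈ nearestPts (D i) v, ∃ p ∈ segment ℝ v q, dist x p ≤ r}

/-- The **TUBE** of the octahedron of `(y, z)`: its own sites, its C-beam tube and its χ-beam tubes. -/
def tube (r r_f ϱ : ℝ) (C : Set E3) (P : PeriodicConfiguration 3) (r₁ : ℝ) (y z : E3) : Set E3 :=
  {x | InOct P r₁ y z x} ∪ tubeC r r_f ϱ C P r₁ y z ∪ tubeD ϱχ D r P r₁ y z

/-- The **BEAM COUNT** at `x`: the number of active octahedra (as ordered shell pairs) whose tube contains `x` (`Set.ncard`; `0` if infinite). -/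
def beamCount (r r_f dK : ℝ) (P : PeriodicConfiguration 3) (C X : Set E3) (τ ϱ r₁ r₂ : ℝ) (x : E3) : ℕ :=
  Set.ncard {p : E3 × E3 | IsActive ϱχ D σ r_f dK P C X τ ϱ r₁ r₂ p.1 p.2 ∧ x ∈ tube ϱχ D r r_f ϱ C P r₁ p.1 p.2}

/-- The **BUDGET ATOM** at a site `x`: its share of the budget of (KX) — `c_T·χ(x)` if `x` is a layer site, minus the S-charge `6κ` if `x` is an
S-vertex, plus `cχ·w(x)·alive(x)·mult(x)²`; zero on the excision. Non-negative as soon as `6κ ≤ c_T` (`atom_nonneg`). -/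
def atom (κ c_T cχ r_f dstar : ℝ) (P : PeriodicConfiguration 3) (C X : Set E3) (ϱ r₁ r₂ : ℝ) (x : E3) : ℝ :=
  if x ∈ X then 0 else
    c_T * (if 0 < profileWeight ϱ C x ∧ profileWeight ϱ C x < 1 then localFactor ϱχ D σ x else 0)
      - 6 * κ * sVertInd ϱχ D σ r_f dstar P C X ϱ r₁ r₂ x
      + cχ * (profileWeight ϱ C x * aliveFactor ϱχ D σ x * (transMult ϱχ D x : ℝ) ^ 2)

/-- The **INCOME** of the octahedron of `(y, z)`: every site `x` of the reference in its tube pays it the share `atom(x)/beamCount(x)`. -/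
def income (r r_f dK dstar κ c_T cχ : ℝ) (P : PeriodicConfiguration 3) (C X : Set E3) (τ ϱ r₁ r₂ : ℝ) (y z : E3) : ℝ :=
  ∑ᶠ x : E3, if x ∈ P.points ∧ x ∈ tube ϱχ D r r_f ϱ C P r₁ y z then
    atom ϱχ D σ κ c_T cχ r_f dstar P C X ϱ r₁ r₂ x / (beamCount ϱχ D σ r r_f dK P C X τ ϱ r₁ r₂ x : ℝ) else 0

variable {ϱχ D σ}

/-- The budget atom is non-negative when the S-charge `6κ` does not exceed `c_T`. [formal bookkeeping] -/
theorem atom_nonneg {κ c_T cχ : ℝ} (hκ : 0 ≤ κ) (h6 : 6 * κ ≤ c_T) (hcχ : 0 ≤ cχ) (r_f dstar : ℝ) (P : PeriodicConfiguration 3)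
    (C X : Set E3) (ϱ r₁ r₂ : ℝ) (x : E3) : 0 ≤ atom ϱχ D σ κ c_T cχ r_f dstar P C X ϱ r₁ r₂ x := by
  unfold atom
  split_ifs with hX hl
  · exact le_rfl
  · have hs : sVertInd ϱχ D σ r_f dstar P C X ϱ r₁ r₂ x ≤ localFactor ϱχ D σ x := by
      unfold sVertInd
      split_ifs with h1
      · rw [h1.1.2.2]
      · exact localFactor_nonneg ϱχ D σ x
    have hs0 := sVertInd_nonneg (ϱχ := ϱχ) (D := D) (σ := σ) r_f dstar P C X ϱ r₁ r₂ x
    have hL1 := localFactor_le_one ϱχ D σ x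
    have hc : 0 ≤ cχ * (profileWeight ϱ C x * aliveFactor ϱχ D σ x * (transMult ϱχ D x : ℝ) ^ 2) :=
      mul_nonneg hcχ (mul_nonneg (mul_nonneg (profileWeight_nonneg _ _ _) (aliveFactor_nonneg ϱχ D σ x)) (by positivity))
    nlinarith
  · have hs : sVertInd ϱχ D σ r_f dstar P C X ϱ r₁ r₂ x = 0 := by
      unfold sVertInd
      rw [if_neg]
      rintro ⟨⟨-, hl', -⟩, -⟩
      exact hl hl'
    rw [hs, mul_zero, mul_zero, sub_zero, zero_add]
    exact mul_nonneg hcχ (mul_nonneg (mul_nonneg (profileWeight_nonneg _ _ _) (aliveFactor_nonneg ϱχ D σ x)) (by positivity))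

/-- The income is non-negative when the atoms are. [formal bookkeeping] -/
theorem income_nonneg {κ c_T cχ : ℝ} (hκ : 0 ≤ κ) (h6 : 6 * κ ≤ c_T) (hcχ : 0 ≤ cχ) (r r_f dK dstar : ℝ) (P : PeriodicConfiguration 3)
    (C X : Set E3) (τ ϱ r₁ r₂ : ℝ) (y z : E3) : 0 ≤ income ϱχ D σ r r_f dK dstar κ c_T cχ P C X τ ϱ r₁ r₂ y z := by
  unfold income
  refine finsum_nonneg fun x => ?_
  split_ifs
  · exact div_nonneg (atom_nonneg hκ h6 hcχ r_f dstar P C X ϱ r₁ r₂ x) (Nat.cast_nonneg _)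
  · exact le_rfl

end Beams

/-! ## §2 The leaves -/

section Leaves

variable (ϱχ : ℝ) {m : ℕ} (D : Fin m → Set E3) (σ : Fin m → Bool)

/-- ★★★ **(B_C) THE CREASE BEAM INEQUALITY** — per octahedron, LOCAL (radius `< ϱ + r`): an ACTIVE CREASED octahedron (feet of its sites more
than `r_f` apart: it straddles the cut locus of `dist(·, C)` — folds, ridges, junctions — at crease depth `< d_K`, whatever its χ-status) is
paid by its INCOME: the two-currency budget atoms of the reference sites in its tube (its own sites, the `r`-tubes around the segments from
its sites to their feet on `closure C`, and — if it touches a χ-transition — the `r`-tubes toward the listed sets in transition), each atom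
shared equally among the active octahedra whose tubes contain it.  `(1/6)·frameVal ≤ income`.
[RESIDUAL-DECIDING · NEW as typed · TRUE-leaning, THIN: by the symmetry of equal sharing the income of a crease octahedron in the starved slab of g76
is its per-area share of the two starved columns — ratio `0.845`, margin `1.18` (inherited from (KX)); V-folds `≤ 0.38`, junction cores `0.14`,
cylinder axes: six radial columns · LOCAL · INSTRUMENTABLE (one octahedron + radius `170`) · ATTACKABLE-L; door [FOLD-TABLE]: (F) a finite
crease-charge table `frameVal ≤ Φ(crease type, depth)` by LP value certificates over the any-feet family (the dictionary `crease_frame` is PROVED)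
∧ (M) a column-mass lemma `income ≥ Φ` (lattice counting in tubes + the profile arithmetic of `φ`, `w_{ϱχ}`)] -/
def CreaseBeamQ (cls : Set E3 → Prop) (r r_f dK dstar κ c_T cχ : ℝ) (s lam ℓ τ ϱ ϱχ r₁ r₂ ρlo ρhi : ℝ) : Prop :=
  ∀ (P : PeriodicConfiguration 3) (C X : Set E3) (m : ℕ) (D : Fin m → Set E3) (σ : Fin m → Bool),
    IsSeparatedRef s P → IsLabelledRef lam ℓ P → cls P.points → IsForceFree P → IsSiteStressFree P →
    IsInvariantSet P C → IsInvariantSet P X → (∀ i, IsInvariantSet P (D i)) → IsFramedOct P r₁ r₂ ρlo ρhi →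
    ∀ y z : E3, IsActive ϱχ D σ r_f dK P C X τ ϱ r₁ r₂ y z → ¬OctTame r_f C P r₁ y z →
      (1 / 6) * frameVal (roofVal T75) τ (siteW ϱχ D σ X ϱ C) P r₁ y z ≤ income ϱχ D σ r r_f dK dstar κ c_T cχ P C X τ ϱ r₁ r₂ y z

/-- ★★★ **(B_D) THE BAND BEAM INEQUALITY** — per octahedron, LOCAL (radius `< ϱχ + r`): an ACTIVE TAME octahedron (one foot cluster on `C`; being
active and tame it TOUCHES A χ-TRANSITION — its cost is the roughness of a localisation factor `w_{ϱχ,Dᵢ}` or `1 − w_{ϱχ,Dᵢ}` across it, worst at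
the far edge `dist(·, Dᵢ) → ϱχ⁻` of a «near Dᵢ» factor) is paid by its income (own sites + χ-beam tubes INTO the transition bands).
[NEW as typed · TRUE-leaning with margin: bulk band, «near» factor edge `(74, 79.5)`: cost `21–62 c_T` per octahedron vs tube income `≈ 200 c_T`
(the band column `(40, t)` of `cχ`-atoms `30 c_T` each shared by `≈ 5.5` costly layers) — margin `≈ 3`; «far» factor edge `(47, 57)`: `≤ 5.4 c_T`
vs `30 c_T` per own site; two crossing bands `≤ 1.82 ×` own mass, same transport · LOCAL (radius `< ϱχ + r`) · INSTRUMENTABLE · ATTACKABLE-L;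
door [EDGE-TABLE]: a one-parameter χ-edge LP table (pattern `u ↦ (1 − w)(t + n·v_u)·w_C`) × in-band column arithmetic; without χ-beams (own
sites only) the statement is FALSE (ratio `2.06`, `num/out_xl_A.txt`)] -/
def BandBeamQ (cls : Set E3 → Prop) (r r_f dK dstar κ c_T cχ : ℝ) (s lam ℓ τ ϱ ϱχ r₁ r₂ ρlo ρhi : ℝ) : Prop :=
  ∀ (P : PeriodicConfiguration 3) (C X : Set E3) (m : ℕ) (D : Fin m → Set E3) (σ : Fin m → Bool),
    IsSeparatedRef s P → IsLabelledRef lam ℓ P → cls P.points → IsForceFree P → IsSiteStressFree P →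
    IsInvariantSet P C → IsInvariantSet P X → (∀ i, IsInvariantSet P (D i)) → IsFramedOct P r₁ r₂ ρlo ρhi →
    ∀ y z : E3, IsActive ϱχ D σ r_f dK P C X τ ϱ r₁ r₂ y z → OctTame r_f C P r₁ y z →
      (1 / 6) * frameVal (roofVal T75) τ (siteW ϱχ D σ X ϱ C) P r₁ y z ≤ income ϱχ D σ r r_f dK dstar κ c_T cχ P C X τ ϱ r₁ r₂ y z

/-- ★★ **(N_B) BEAM INCIDENCE** (periodic double counting): summed over the active shell pairs of one period, the incomes amount to at most the
budget of (KX) without the near-priced term — every site's atom is shared among the active octahedra whose tubes contain it, shares sum to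
`≤ 1`, and the sum over one period of pairs against all sites refolds to the sum over one period of sites against all pairs (lattice
invariance of `atom`, `tube`, `IsActive`). [support · TRUE · ATTACKABLE-M (periodic Fubini, as (I₃₆)) · no LP content] -/
def BeamIncidenceQ (cls : Set E3 → Prop) (r r_f dK dstar κ c_T cχ : ℝ) (s lam ℓ τ ϱ ϱχ r₁ r₂ : ℝ) : Prop :=
  ∀ (P : PeriodicConfiguration 3) (C X : Set E3) (m : ℕ) (D : Fin m → Set E3) (σ : Fin m → Bool),
    IsSeparatedRef s P → IsLabelledRef lam ℓ P → cls P.points → IsInvariantSet P C → IsInvariantSet P X → (∀ i, IsInvariantSet P (D i)) →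
      ∑ y ∈ P.motif, ∑ᶠ z : E3, (if (z ∈ P.points ∧ r₁ < dist y z ∧ dist y z ≤ r₂) ∧ IsActive ϱχ D σ r_f dK P C X τ ϱ r₁ r₂ y z then
          income ϱχ D σ r r_f dK dstar κ c_T cχ P C X τ ϱ r₁ r₂ y z else 0) ≤
        c_T * shellMassL ϱχ D σ P X ϱ C - 6 * κ * sVertMassL ϱχ D σ r_f dstar P C X ϱ r₁ r₂ + cχ * transMassL ϱχ D σ P X ϱ C

end Leaves

/-! ## §3 The any-feet crease dictionary and the bridge (Z_K) ⟹ deep creases are free -/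

section Bridge

variable {ϱχ : ℝ} {m : ℕ} {D : Fin m → Set E3} {σ : Fin m → Bool}

/-- `w < 1` forces `dist(q, C) < ϱ` (beyond `ϱ` the profile is identically `1`). [formal bookkeeping] -/
theorem infDist_lt_of_profileWeight_lt_one {ϱ : ℝ} {C : Set E3} {q : E3} (hϱ : 0 < ϱ) (h : profileWeight ϱ C q < 1) :
    Metric.infDist q C < ϱ := by
  by_contra hle
  push Not at hle
  have harg : 2 - 2 * Metric.infDist q C / ϱ ≤ 0 := by
    rw [sub_nonpos, le_div_iff₀ hϱ]; linarith
  have h1 : profileWeight ϱ C q = 1 := by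
    unfold profileWeight; rw [smoothStep_of_le_zero harg]; norm_num
  linarith

/-- ★★ **THE CREASE FRAME (PROVED; any-feet dictionary)**: a χ-free clean non-plateau shell octahedron of a framed reference — tame OR CREASED —
carries an anchored orthonormal frame `(c, f, ρ)`, `ρ` in the window, whose six vertices are exactly its sites, with localisation factor `1`,
weights `W = profileWeight`, and six feet `q_u ∈ closure C` — a nearest point of each vertex (`C ≠ ∅`: an empty `C` makes every weight `0`, a
plateau) — within `2ϱ + 6ρ` of each other (some vertex has weight `< 1`, hence depth `< ϱ`; the others are within `2ρ`), such that the six-feet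
depth of every vertex IS its distance to `C`: `W∘vertices = φ∘feetDepth`. -/
theorem crease_frame {P : PeriodicConfiguration 3} {C X : Set E3} {ϱ r₁ r₂ ρlo ρhi : ℝ} {y z : E3}
    (hϱ : 0 < ϱ) (hϱχ : 0 < ϱχ) (hr₁ : 0 ≤ r₁) (hsmall : 2 * (r₁ + r₂) < ϱχ / 2) (hlo : 0 < ρlo) (hFr : IsFramedOct P r₁ r₂ ρlo ρhi)
    (hy : y ∈ P.points) (hz : z ∈ P.points) (hd1 : r₁ < dist y z) (hd2 : dist y z ≤ r₂) (hclean : OctClean P r₁ X y z)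
    (hplat : ¬OctPlateau P r₁ (siteW ϱχ D σ X ϱ C) y z) (hcf : OctChiFree ϱχ D P r₁ y z) :
    ∃ (c : E3) (f : Fin 3 → E3) (ρ : ℝ) (q : Fin 3 × Bool → E3), Orthonormal ℝ f ∧ 0 < ρ ∧ ρlo ≤ ρ ∧ ρ ≤ ρhi ∧
      octVertex c f ρ 0 false = y ∧ octVertex c f ρ 0 true = z ∧ (∀ x, InOct P r₁ y z x ↔ ∃ i b, x = octVertex c f ρ i b) ∧
      (∀ u, q u ∈ nearestPts C (octVertex c f ρ u.1 u.2)) ∧ (∀ u u', dist (q u) (q u') ≤ 2 * ϱ + 6 * ρ) ∧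
      (∀ u, feetDepth c f ρ q u = Metric.infDist (octVertex c f ρ u.1 u.2) C) ∧
      (∀ x, InOct P r₁ y z x → localFactor ϱχ D σ x = 1) ∧ (∀ x, InOct P r₁ y z x → siteW ϱχ D σ X ϱ C x = profileWeight ϱ C x) ∧
      (fun p : Fin 3 × Bool => siteW ϱχ D σ X ϱ C (octVertex c f ρ p.1 p.2)) = fun u => depthProfile ϱ (feetDepth c f ρ q u) := by
  obtain ⟨c, f, ρ, hf, hρ1, hρ2, hyv, hzv, hO⟩ := hFr y hy z hz hd1 hd2
  have hρ : 0 < ρ := lt_of_lt_of_le hlo hρ1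
  have hvert : ∀ u : Fin 3 × Bool, InOct P r₁ y z (octVertex c f ρ u.1 u.2) := fun u => (hO _).2 ⟨u.1, u.2, rfl⟩
  have hnear : ∀ x x', InOct P r₁ y z x → InOct P r₁ y z x' → dist x x' < ϱχ / 2 := by
    intro x x' hx hx'
    have h1 := dist_le_of_inOct (P := P) hr₁ hd2 hx
    have h2 := dist_le_of_inOct (P := P) hr₁ hd2 hx'
    have h3 := dist_triangle x y x'
    rw [dist_comm x y] at h3
    linarith
  -- the localisation factor is 1 on the octahedron
  have hone : ∃ x, InOct P r₁ y z x ∧ localFactor ϱχ D σ x = 1 := by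
    by_contra hno
    push Not at hno
    have hzero : ∀ x, InOct P r₁ y z x → siteW ϱχ D σ X ϱ C x = 0 := by
      intro x hx
      rcases localFactor_eq_zero_or_one_of_transMult_eq_zero (σ := σ) (hcf x hx) with h0 | h1
      · unfold siteW
        split_ifs
        · rfl
        · rw [h0, zero_mul]
      · exact absurd h1 (hno x hx)
    exact hplat fun x x' hx hx' => by rw [hzero x hx, hzero x' hx']
  obtain ⟨x₀, hx₀, hlf₀⟩ := hone
  have hlf : ∀ x, InOct P r₁ y z x → localFactor ϱχ D σ x = 1 := fun x hx =>
    localFactor_eq_one_of_near hϱχ (hcf x₀ hx₀) (hcf x hx) (hnear x₀ x hx₀ hx) hlf₀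
  have hWx : ∀ x, InOct P r₁ y z x → siteW ϱχ D σ X ϱ C x = profileWeight ϱ C x := fun x hx => by
    unfold siteW
    rw [if_neg (hclean x hx), hlf x hx, one_mul]
  -- `C` is nonempty (else every weight is `0`: a plateau)
  have hne : C.Nonempty := by
    by_contra hC
    rw [Set.not_nonempty_iff_eq_empty] at hC
    exact hplat fun x x' hx hx' => by rw [hWx x hx, hWx x' hx', hC, profileWeight_empty, profileWeight_empty]
  -- the feet: nearest points of the closure
  have hex := fun u : Fin 3 × Bool => Metric.exists_mem_closure_infDist_eq_dist hne (octVertex c f ρ u.1 u.2)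
  choose q hqmem hqd using hex
  have hfd : ∀ u, feetDepth c f ρ q u = Metric.infDist (octVertex c f ρ u.1 u.2) C := by
    intro u
    apply le_antisymm
    · have hle := Finset.inf'_le (fun u' => dist (octVertex c f ρ u.1 u.2) (q u')) (Finset.mem_univ u)
      unfold feetDepth
      exact hle.trans_eq (hqd u).symm
    · unfold feetDepth
      refine Finset.le_inf' _ _ fun u' _ => ?_
      have hle := Metric.infDist_le_dist_of_mem (x := octVertex c f ρ u.1 u.2) (hqmem u')
      rw [Metric.infDist_closure] at hle
      exact hle
  -- some vertex is shallower than `ϱ` (else all weights are `1`: a plateau)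
  have hsh : ∃ u₀ : Fin 3 × Bool, Metric.infDist (octVertex c f ρ u₀.1 u₀.2) C < ϱ := by
    by_contra hno
    push Not at hno
    have h1 : ∀ x, InOct P r₁ y z x → siteW ϱχ D σ X ϱ C x = 1 := by
      intro x hx
      obtain ⟨i, b, rfl⟩ := (hO x).1 hx
      rw [hWx _ hx]
      by_contra hne1
      have hlt : profileWeight ϱ C (octVertex c f ρ i b) < 1 := lt_of_le_of_ne (profileWeight_le_one _ _ _) hne1
      exact absurd (infDist_lt_of_profileWeight_lt_one hϱ hlt) (not_lt.2 (hno (i, b)))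
    exact hplat fun x x' hx hx' => by rw [h1 x hx, h1 x' hx']
  obtain ⟨u₀, hu₀⟩ := hsh
  have hdepth : ∀ u : Fin 3 × Bool, Metric.infDist (octVertex c f ρ u.1 u.2) C ≤ ϱ + 2 * ρ := by
    intro u
    have h1 : Metric.infDist (octVertex c f ρ u.1 u.2) C ≤
        Metric.infDist (octVertex c f ρ u₀.1 u₀.2) C + dist (octVertex c f ρ u.1 u.2) (octVertex c f ρ u₀.1 u₀.2) :=
      Metric.infDist_le_infDist_add_dist
    have h2 := dist_octVertex_le (c := c) hf hρ.le u.1 u₀.1 u.2 u₀.2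
    linarith
  refine ⟨c, f, ρ, q, hf, hρ, hρ1, hρ2, hyv, hzv, hO, fun u => ⟨hqmem u, (hqd u).symm⟩, fun u u' => ?_, hfd, hlf, hWx, ?_⟩
  · have h1 : dist (q u) (octVertex c f ρ u.1 u.2) ≤ ϱ + 2 * ρ := by rw [dist_comm, ← hqd u]; exact hdepth u
    have h2 : dist (octVertex c f ρ u'.1 u'.2) (q u') ≤ ϱ + 2 * ρ := by rw [← hqd u']; exact hdepth u'
    have h3 := dist_octVertex_le (c := c) hf hρ.le u.1 u'.1 u.2 u'.2
    have h4 := dist_triangle4 (q u) (octVertex c f ρ u.1 u.2) (octVertex c f ρ u'.1 u'.2) (q u')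
    linarith
  · funext u
    rw [hWx _ (hvert u), profileWeight_eq_depthProfile, hfd]

/-- ★★★ **THE BRIDGE (Z_K) ⟹ DEEP CREASES ARE FREE (PROVED)**: the any-feet zero cone with feet diameter `R_Z ≥ 2ϱ + 6ρhi` at depth `d_K` kills
the frame-infimum of every χ-free clean non-plateau shell octahedron all of whose sites have depth `≥ d_K` — tame or creased. -/
theorem frameVal_nonpos_of_anyFeetZeroCone {P : PeriodicConfiguration 3} {C X : Set E3} {R_Z dK τ ϱ r₁ r₂ ρlo ρhi : ℝ} {y z : E3}
    (hϱ : 0 < ϱ) (hϱχ : 0 < ϱχ) (hr₁ : 0 ≤ r₁) (hsmall : 2 * (r₁ + r₂) < ϱχ / 2) (hlo : 0 < ρlo) (hR : 2 * ϱ + 6 * ρhi ≤ R_Z)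
    (hZ : SixFeetZeroConeQ ρlo ρhi R_Z dK ϱ) (hFr : IsFramedOct P r₁ r₂ ρlo ρhi)
    (hy : y ∈ P.points) (hz : z ∈ P.points) (hd1 : r₁ < dist y z) (hd2 : dist y z ≤ r₂) (hclean : OctClean P r₁ X y z)
    (hplat : ¬OctPlateau P r₁ (siteW ϱχ D σ X ϱ C) y z) (hcf : OctChiFree ϱχ D P r₁ y z) (hdp : OctDeep dK C P r₁ y z) :
    frameVal (roofVal T75) τ (siteW ϱχ D σ X ϱ C) P r₁ y z ≤ 0 := by
  obtain ⟨c, f, ρ, q, hf, hρ, hρ1, hρ2, hyv, hzv, hO, -, hdiam, hfd, -, -, hfun⟩ :=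
    crease_frame (σ := σ) (X := X) hϱ hϱχ hr₁ hsmall hlo hFr hy hz hd1 hd2 hclean hplat hcf
  have hvert : ∀ u : Fin 3 × Bool, InOct P r₁ y z (octVertex c f ρ u.1 u.2) := fun u => (hO _).2 ⟨u.1, u.2, rfl⟩
  have hzero : roofVal T75 (fun p : Fin 3 × Bool => siteW ϱχ D σ X ϱ C (octVertex c f ρ p.1 p.2)) = 0 := by
    rw [hfun]
    refine hZ ρ hρ1 hρ2 c f hf q (fun u u' => (hdiam u u').trans (by linarith)) fun u => by rw [hfd]; exact hdp _ (hvert u)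
  have hmem : (τ * (2 * ρ)) ^ 2 * roofVal T75 (fun p : Fin 3 × Bool => siteW ϱχ D σ X ϱ C (octVertex c f ρ p.1 p.2)) ∈
      frameValSet (roofVal T75) τ (siteW ϱχ D σ X ϱ C) P r₁ y z :=
    ⟨c, f, ρ, hf, hρ, hyv, hzv, hO, rfl⟩
  rw [hzero, mul_zero] at hmem
  exact frameVal_le_of_mem hmem le_rfl le_rfl

end Bridge

end Summit.AtomisticToContinuum.Crystallization.Theorems.ChargedEnergyGapChartDial
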